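import Literature.Barriers.CriticalPhenomena.PlanarEdwardsModelDiffusiveSILTBlocks
import HarnessLib

/-!
# Mollified self-intersection local time: binary splitting and Brownian scaling
# (towards the exponential moments, Varadhan's renormalisation part (ii))

Sibling file of `Literature.Barriers.CriticalPhenomena.PlanarEdwardsModelDiffusive`. For a planar
Brownian motion `Z` the time square splits as
`T_{2k} = B_{2k}([0,½]²) + B_{2k}([½,1]²) + 2 B_{2k}([0,½]×[½,1])` (`mollifiedSILT_split`), and the
two diagonal blocks are, PATHWISE, half the mollified self-intersection local times at level `k`
of the two rescaled halves of the path,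

* `Edwards2D.halfScale Z`: `t ↦ √2 · Z_{t/2}`,
* `Edwards2D.halfShiftScale Z`: `t ↦ √2 · (Z_{½ + t/2} - Z_½)`,

namely `B_{2k}([0,½]²) = ½ T_k(halfScale Z)` and `B_{2k}([½,1]²) = ½ T_k(halfShiftScale Z)`
(`blockSILT_lowerDiag`, `blockSILT_upperDiag`; the identity `g_{2k}(y/√2) = 2 g_k(y)` and the
change of variables `s = s'/2`). Both rescaled halves are again planar Brownian motions with
measurable marginals and continuous paths (`isBrownianComplex_halfScale`,
`isBrownianComplex_halfShiftScale`: Mathlib's `IsBrownianReal.smul`, `IsBrownianReal.shift`).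
This is the self-similarity `α(Aⁿ_k) =(d) 2⁻ⁿ α` of Le Gall 1994, (ii), in the pathwise form needed
for the induction on the dyadic level.

## References

* J.-F. Le Gall, Sém. Prob. XXVIII, LNM 1583 (1994), 172–180, (4)–(5) and facts (i)–(iii).
-/

noncomputable section

open MeasureTheory ProbabilityTheory Real Filter Set Function
open scoped NNReal ENNReal Topology

namespace Literature.Barriers.CriticalPhenomena

namespace Edwards2D

open Literature.Probability.Process

universe u

variable {Ω : Type u} {Z : ℝ≥0 → Ω → ℂ}

/-! ### The two rescaled halves of the path -/

/-- The rescaled first half of the path, `t ↦ √2 · Z_{t/2}` (Brownian scaling with `c = ½`).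
[cite: LeGall1994, fact (ii) after (5)] -/
def halfScale (Z : ℝ≥0 → Ω → ℂ) (t : ℝ≥0) (ω : Ω) : ℂ := (Real.sqrt 2 : ℂ) * Z (t / 2) ω

/-- The rescaled second half of the path, `t ↦ √2 · (Z_{½ + t/2} - Z_½)` (shift at `½`, then
Brownian scaling with `c = ½`). [cite: LeGall1994, fact (ii) after (5)] -/
def halfShiftScale (Z : ℝ≥0 → Ω → ℂ) (t : ℝ≥0) (ω : Ω) : ℂ :=
  (Real.sqrt 2 : ℂ) * (Z (1 / 2 + t / 2) ω - Z (1 / 2) ω)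

/-- Continuity of paths is preserved by `halfScale`. [folklore] -/
theorem continuous_halfScale (hcont : ∀ ω, Continuous (Z · ω)) (ω : Ω) :
    Continuous (halfScale Z · ω) := by
  unfold halfScale
  exact continuous_const.mul ((hcont ω).comp (continuous_id.div_const _))

/-- Continuity of paths is preserved by `halfShiftScale`. [folklore] -/
theorem continuous_halfShiftScale (hcont : ∀ ω, Continuous (Z · ω)) (ω : Ω) :
    Continuous (halfShiftScale Z · ω) := by
  unfold halfShiftScale
  exact continuous_const.mul (((hcont ω).comp (continuous_const.add (continuous_id.div_const _))).sub
    continuous_const)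

section Measurable

variable [MeasurableSpace Ω] {P : Measure Ω}

/-- Measurability of marginals is preserved by `halfScale`. [folklore] -/
theorem measurable_halfScale (hmeas : ∀ t, Measurable (Z t)) (t : ℝ≥0) :
    Measurable (halfScale Z t) :=
  (hmeas _).const_mul _

/-- Measurability of marginals is preserved by `halfShiftScale`. [folklore] -/
theorem measurable_halfShiftScale (hmeas : ∀ t, Measurable (Z t)) (t : ℝ≥0) :
    Measurable (halfShiftScale Z t) :=
  ((hmeas _).sub (hmeas _)).const_mul _

/-- The scaling constant: `(√(½))⁻¹ = √2` (Mathlib's `IsBrownianReal.smul` normalisation).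
[folklore] -/
theorem inv_sqrt_half : (Real.sqrt ((1 / 2 : ℝ≥0) : ℝ))⁻¹ = Real.sqrt 2 := by
  rw [show ((1 / 2 : ℝ≥0) : ℝ) = 1 / 2 by norm_num, Real.sqrt_div' 1 zero_le_two, Real.sqrt_one, inv_div,
    div_one]

/-- The path functional `p ↦ (t ↦ √2 p(t/2))` on real paths is measurable. [folklore] -/
theorem measurable_pathScale : Measurable fun (p : ℝ≥0 → ℝ) (t : ℝ≥0) => Real.sqrt 2 * p (t / 2) :=
  measurable_pi_lambda _ fun t => (measurable_pi_apply (t / 2)).const_mul _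

/-- The path functional `p ↦ (t ↦ √2 (p(½ + t/2) - p(½)))` on real paths is measurable. [folklore] -/
theorem measurable_pathShiftScale :
    Measurable fun (p : ℝ≥0 → ℝ) (t : ℝ≥0) => Real.sqrt 2 * (p (1 / 2 + t / 2) - p (1 / 2)) :=
  measurable_pi_lambda _ fun t =>
    ((measurable_pi_apply (1 / 2 + t / 2)).sub (measurable_pi_apply (1 / 2))).const_mul _

/-- **The rescaled first half is a planar Brownian motion** (Brownian scaling of the real and
imaginary parts, Mathlib's `IsBrownianReal.smul` with `c = ½`; independence of the parts is
transported along the measurable path functional). [cite: LeGall1994, fact (ii) after (5)] -/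
theorem isBrownianComplex_halfScale (hZ : IsBrownianComplex Z P) : IsBrownianComplex (halfScale Z) P := by
  have hc : (1 / 2 : ℝ≥0) ≠ 0 := by norm_num
  have hre_eq : (fun t ω => (halfScale Z t ω).re) =
      fun t ω => (Real.sqrt ((1 / 2 : ℝ≥0) : ℝ))⁻¹ * (Z ((1 / 2 : ℝ≥0) * t) ω).re := by
    funext t ω
    rw [inv_sqrt_half, halfScale, Complex.re_ofReal_mul, div_eq_inv_mul, one_div]
  have him_eq : (fun t ω => (halfScale Z t ω).im) =
      fun t ω => (Real.sqrt ((1 / 2 : ℝ≥0) : ℝ))⁻¹ * (Z ((1 / 2 : ℝ≥0) * t) ω).im := by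
    funext t ω
    rw [inv_sqrt_half, halfScale, Complex.im_ofReal_mul, div_eq_inv_mul, one_div]
  refine ⟨?_, ?_, ?_⟩
  · rw [hre_eq]; exact hZ.re.smul hc
  · rw [him_eq]; exact hZ.im.smul hc
  · have h := hZ.indepFun.comp measurable_pathScale measurable_pathScale
    have e1 : ((fun (p : ℝ≥0 → ℝ) (t : ℝ≥0) => Real.sqrt 2 * p (t / 2)) ∘ fun ω t => (Z t ω).re) =
        fun ω t => (halfScale Z t ω).re := by
      funext ω t; simp [halfScale]
    have e2 : ((fun (p : ℝ≥0 → ℝ) (t : ℝ≥0) => Real.sqrt 2 * p (t / 2)) ∘ fun ω t => (Z t ω).im) =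
        fun ω t => (halfScale Z t ω).im := by
      funext ω t; simp [halfScale]
    rw [e1, e2] at h
    exact h

/-- **The rescaled second half is a planar Brownian motion** (weak Markov shift at `½`, Mathlib's
`IsBrownianReal.shift`, then scaling). [cite: LeGall1994, fact (ii) after (5)] -/
theorem isBrownianComplex_halfShiftScale (hZ : IsBrownianComplex Z P) :
    IsBrownianComplex (halfShiftScale Z) P := by
  have hc : (1 / 2 : ℝ≥0) ≠ 0 := by norm_num
  have hre_eq : (fun t ω => (halfShiftScale Z t ω).re) =
      fun t ω => (Real.sqrt ((1 / 2 : ℝ≥0) : ℝ))⁻¹ *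
        ((Z ((1 / 2 : ℝ≥0) + (1 / 2 : ℝ≥0) * t) ω).re - (Z (1 / 2) ω).re) := by
    funext t ω
    rw [inv_sqrt_half, halfShiftScale, Complex.re_ofReal_mul, Complex.sub_re, div_eq_inv_mul t,
      one_div]
  have him_eq : (fun t ω => (halfShiftScale Z t ω).im) =
      fun t ω => (Real.sqrt ((1 / 2 : ℝ≥0) : ℝ))⁻¹ *
        ((Z ((1 / 2 : ℝ≥0) + (1 / 2 : ℝ≥0) * t) ω).im - (Z (1 / 2) ω).im) := by
    funext t ω
    rw [inv_sqrt_half, halfShiftScale, Complex.im_ofReal_mul, Complex.sub_im, div_eq_inv_mul t,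
      one_div]
  refine ⟨?_, ?_, ?_⟩
  · rw [hre_eq]; exact (hZ.re.shift (1 / 2)).smul hc
  · rw [him_eq]; exact (hZ.im.shift (1 / 2)).smul hc
  · have h := hZ.indepFun.comp measurable_pathShiftScale measurable_pathShiftScale
    have e1 : ((fun (p : ℝ≥0 → ℝ) (t : ℝ≥0) => Real.sqrt 2 * (p (1 / 2 + t / 2) - p (1 / 2))) ∘
        fun ω t => (Z t ω).re) = fun ω t => (halfShiftScale Z t ω).re := by
      funext ω t; simp [halfShiftScale]
    have e2 : ((fun (p : ℝ≥0 → ℝ) (t : ℝ≥0) => Real.sqrt 2 * (p (1 / 2 + t / 2) - p (1 / 2))) ∘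
        fun ω t => (Z t ω).im) = fun ω t => (halfShiftScale Z t ω).im := by
      funext ω t; simp [halfShiftScale]
    rw [e1, e2] at h
    exact h

end Measurable

/-! ### The kernel identity `g_{2k}(y/√2) = 2 g_k(y)` and the pathwise scaling of blocks -/

/-- `|√2 · y|² = 2|y|²`. [folklore] -/
theorem norm_sqrt_two_mul_sq (y : ℂ) : ‖(Real.sqrt 2 : ℂ) * y‖ ^ 2 = 2 * ‖y‖ ^ 2 := by
  rw [norm_mul, Complex.norm_real, Real.norm_eq_abs, abs_of_nonneg (Real.sqrt_nonneg 2), mul_pow,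
    Real.sq_sqrt zero_le_two]

/-- **`g_{2k}(y) = 2 g_k(√2 y)`**. [cite: LeGall1985, §0 (definition of g_k)] -/
theorem gaussKernel_two_mul (k : ℕ) (y : ℂ) :
    gaussKernel (2 * k) y = 2 * gaussKernel k ((Real.sqrt 2 : ℂ) * y) := by
  simp only [gaussKernel, norm_sqrt_two_mul_sq]
  push_cast
  ring_nf

/-- Halving commutes with the clamp: `(x/2)⁺ = x⁺/2` in `ℝ≥0`. [folklore] -/
theorem toNNReal_half (x : ℝ) : (x / 2).toNNReal = x.toNNReal / 2 := by
  apply NNReal.eq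
  rw [NNReal.coe_div, Real.coe_toNNReal', Real.coe_toNNReal', NNReal.coe_ofNat]
  rcases le_total 0 x with h | h
  · rw [max_eq_left h, max_eq_left (by linarith)]
  · rw [max_eq_right h, max_eq_right (by linarith), zero_div]

/-- For `x ≥ 0`: `(½ + x/2)⁺ = ½ + x⁺/2` in `ℝ≥0`. [folklore] -/
theorem toNNReal_half_add {x : ℝ} (hx : 0 ≤ x) : (1 / 2 + x / 2).toNNReal = 1 / 2 + x.toNNReal / 2 := by
  apply NNReal.eq
  rw [Real.coe_toNNReal _ (by linarith)]
  push_cast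
  rw [Real.coe_toNNReal _ hx]

/-- **Kernel process under scaling of the first half**: for `s, t ≥ 0`,
`H_{2k}^Z(s/2, t/2) = 2 H_k^{halfScale Z}(s, t)`. [folklore] -/
theorem kernelProc_halfScale (k : ℕ) (s t : ℝ) (ω : Ω) :
    kernelProc Z (2 * k) (s / 2, t / 2) ω = 2 * kernelProc (halfScale Z) k (s, t) ω := by
  simp only [kernelProc, halfScale, toNNReal_half, gaussKernel_two_mul, mul_sub]

/-- **Kernel process under scaling of the second half**: for `s, t ≥ 0`,
`H_{2k}^Z(½ + s/2, ½ + t/2) = 2 H_k^{halfShiftScale Z}(s, t)`. [folklore] -/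
theorem kernelProc_halfShiftScale (k : ℕ) {s t : ℝ} (hs : 0 ≤ s) (ht : 0 ≤ t) (ω : Ω) :
    kernelProc Z (2 * k) (1 / 2 + s / 2, 1 / 2 + t / 2) ω = 2 * kernelProc (halfShiftScale Z) k (s, t) ω := by
  simp only [kernelProc, halfShiftScale, toNNReal_half_add hs, toNNReal_half_add ht, gaussKernel_two_mul]
  congr 2
  ring

/-- Iterated-integral form of `T_k` through the kernel process (Fubini, `g_k` even).
[folklore] -/
theorem mollifiedSILT_eq_integral_integral (hcont : ∀ ω, Continuous (Z · ω)) (k : ℕ) (ω : Ω) :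
    mollifiedSILT Z k ω = ∫ s in Icc (0 : ℝ) 1, ∫ t in Icc (0 : ℝ) 1, kernelProc Z k (s, t) ω := by
  rw [← blockSILT_unit hcont, blockSILT_eq_integral_integral hcont]

/-- **Pathwise scaling of the lower diagonal block**: `B_{2k}([0,½]²) = ½ T_k(halfScale Z)`
(change of variables `s = s'/2`, `t = t'/2` and `g_{2k}(y/√2) = 2 g_k(y)`).
[cite: LeGall1994, fact (ii) after (5)] -/
theorem blockSILT_lowerDiag (hcont : ∀ ω, Continuous (Z · ω)) (k : ℕ) (ω : Ω) :
    blockSILT Z (2 * k) 0 (1 / 2) 0 (1 / 2) ω = 1 / 2 * mollifiedSILT (halfScale Z) k ω := by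
  rw [blockSILT_eq_integral_integral hcont,
    mollifiedSILT_eq_integral_integral (continuous_halfScale hcont) k ω]
  -- inner change of variables
  have hinner : ∀ s : ℝ, ∫ t in Icc (0 : ℝ) (1 / 2), kernelProc Z (2 * k) (s, t) ω =
      1 / 2 * ∫ t in Icc (0 : ℝ) 1, kernelProc Z (2 * k) (s, t / 2) ω := by
    intro s
    rw [integral_Icc_eq_integral_Ioc, integral_Icc_eq_integral_Ioc,
      ← intervalIntegral.integral_of_le (by norm_num : (0 : ℝ) ≤ 1 / 2),
      ← intervalIntegral.integral_of_le (by norm_num : (0 : ℝ) ≤ 1),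
      intervalIntegral.integral_comp_div (fun t => kernelProc Z (2 * k) (s, t) ω) two_ne_zero]
    norm_num
    ring
  simp_rw [hinner]
  rw [integral_const_mul]
  -- outer change of variables
  have houter : ∫ s in Icc (0 : ℝ) (1 / 2), ∫ t in Icc (0 : ℝ) 1, kernelProc Z (2 * k) (s, t / 2) ω =
      1 / 2 * ∫ s in Icc (0 : ℝ) 1, ∫ t in Icc (0 : ℝ) 1, kernelProc Z (2 * k) (s / 2, t / 2) ω := by
    rw [integral_Icc_eq_integral_Ioc, integral_Icc_eq_integral_Ioc,
      ← intervalIntegral.integral_of_le (by norm_num : (0 : ℝ) ≤ 1 / 2),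
      ← intervalIntegral.integral_of_le (by norm_num : (0 : ℝ) ≤ 1),
      intervalIntegral.integral_comp_div
        (fun s => ∫ t in Icc (0 : ℝ) 1, kernelProc Z (2 * k) (s, t / 2) ω) two_ne_zero]
    norm_num
    ring
  rw [houter]
  simp_rw [kernelProc_halfScale]
  rw [show (fun s => ∫ t in Icc (0 : ℝ) 1, 2 * kernelProc (halfScale Z) k (s, t) ω) =
      fun s => 2 * ∫ t in Icc (0 : ℝ) 1, kernelProc (halfScale Z) k (s, t) ω from
    funext fun s => integral_const_mul _ _, integral_const_mul]
  ring

/-- **Pathwise scaling of the upper diagonal block**: `B_{2k}([½,1]²) = ½ T_k(halfShiftScale Z)`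
(change of variables `s = ½ + s'/2`, `t = ½ + t'/2`). [cite: LeGall1994, fact (ii) after (5)] -/
theorem blockSILT_upperDiag (hcont : ∀ ω, Continuous (Z · ω)) (k : ℕ) (ω : Ω) :
    blockSILT Z (2 * k) (1 / 2) 1 (1 / 2) 1 ω = 1 / 2 * mollifiedSILT (halfShiftScale Z) k ω := by
  rw [blockSILT_eq_integral_integral hcont,
    mollifiedSILT_eq_integral_integral (continuous_halfShiftScale hcont) k ω]
  -- inner change of variables
  have hinner : ∀ s : ℝ, ∫ t in Icc (1 / 2 : ℝ) 1, kernelProc Z (2 * k) (s, t) ω =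
      1 / 2 * ∫ t in Icc (0 : ℝ) 1, kernelProc Z (2 * k) (s, 1 / 2 + t / 2) ω := by
    intro s
    rw [integral_Icc_eq_integral_Ioc, integral_Icc_eq_integral_Ioc,
      ← intervalIntegral.integral_of_le (by norm_num : (1 / 2 : ℝ) ≤ 1),
      ← intervalIntegral.integral_of_le (by norm_num : (0 : ℝ) ≤ 1),
      intervalIntegral.integral_comp_add_div (fun t => kernelProc Z (2 * k) (s, t) ω) two_ne_zero]
    norm_num
    ring
  simp_rw [hinner]
  rw [integral_const_mul]
  -- outer change of variables
  have houter : ∫ s in Icc (1 / 2 : ℝ) 1, ∫ t in Icc (0 : ℝ) 1, kernelProc Z (2 * k) (s, 1 / 2 + t / 2) ω =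
      1 / 2 * ∫ s in Icc (0 : ℝ) 1, ∫ t in Icc (0 : ℝ) 1,
        kernelProc Z (2 * k) (1 / 2 + s / 2, 1 / 2 + t / 2) ω := by
    rw [integral_Icc_eq_integral_Ioc, integral_Icc_eq_integral_Ioc,
      ← intervalIntegral.integral_of_le (by norm_num : (1 / 2 : ℝ) ≤ 1),
      ← intervalIntegral.integral_of_le (by norm_num : (0 : ℝ) ≤ 1),
      intervalIntegral.integral_comp_add_div
        (fun s => ∫ t in Icc (0 : ℝ) 1, kernelProc Z (2 * k) (s, 1 / 2 + t / 2) ω) two_ne_zero]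
    norm_num
    ring
  rw [houter]
  -- the kernel identity holds on `[0,1]²`
  have hcongr : ∫ s in Icc (0 : ℝ) 1, ∫ t in Icc (0 : ℝ) 1,
      kernelProc Z (2 * k) (1 / 2 + s / 2, 1 / 2 + t / 2) ω =
      ∫ s in Icc (0 : ℝ) 1, ∫ t in Icc (0 : ℝ) 1, 2 * kernelProc (halfShiftScale Z) k (s, t) ω := by
    refine setIntegral_congr_fun measurableSet_Icc fun s hs => ?_
    exact setIntegral_congr_fun measurableSet_Icc fun t ht => kernelProc_halfShiftScale k hs.1 ht.1 ω
  rw [hcongr]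
  rw [show (fun s => ∫ t in Icc (0 : ℝ) 1, 2 * kernelProc (halfShiftScale Z) k (s, t) ω) =
      fun s => 2 * ∫ t in Icc (0 : ℝ) 1, kernelProc (halfShiftScale Z) k (s, t) ω from
    funext fun s => integral_const_mul _ _, integral_const_mul]
  ring

/-! ### The binary splitting of the time square -/

/-- Lebesgue measure on `[0,1]` splits at `½` (the overlap `{½}` is null). [folklore] -/
theorem restrict_unitInterval_split :
    (volume.restrict (Icc (0 : ℝ) 1) : Measure ℝ) =
      volume.restrict (Icc (0 : ℝ) (1 / 2)) + volume.restrict (Icc (1 / 2 : ℝ) 1) := by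
  rw [← Icc_union_Icc_eq_Icc (by norm_num : (0 : ℝ) ≤ 1 / 2) (by norm_num : (1 / 2 : ℝ) ≤ 1)]
  refine Measure.restrict_union₀ ?_ measurableSet_Icc.nullMeasurableSet
  rw [AEDisjoint, Icc_inter_Icc_eq_singleton (by norm_num : (0 : ℝ) ≤ 1 / 2) (by norm_num : (1 / 2 : ℝ) ≤ 1)]
  exact measure_singleton _

/-- The unit square is the sum of its four quarter blocks. [folklore] -/
theorem unitSq_split :
    unitSq = rect 0 (1 / 2) 0 (1 / 2) + rect 0 (1 / 2) (1 / 2) 1 +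
      (rect (1 / 2) 1 0 (1 / 2) + rect (1 / 2) 1 (1 / 2) 1) := by
  simp only [unitSq, rect, restrict_unitInterval_split, Measure.prod_add, Measure.add_prod]
  abel

/-- The kernel process is symmetric in the two times. [folklore] -/
theorem kernelProc_swap (k : ℕ) (p : ℝ × ℝ) (ω : Ω) : kernelProc Z k p.swap ω = kernelProc Z k p ω := by
  simp only [kernelProc, Prod.fst_swap, Prod.snd_swap]
  rw [← gaussKernel_neg, neg_sub]

/-- The two off-diagonal blocks agree: `B_k([½,1]×[0,½]) = B_k([0,½]×[½,1])`. [folklore] -/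
theorem blockSILT_offDiag_swap (k : ℕ) (ω : Ω) :
    blockSILT Z k (1 / 2) 1 0 (1 / 2) ω = blockSILT Z k 0 (1 / 2) (1 / 2) 1 ω := by
  simp only [blockSILT, rect]
  rw [← integral_prod_swap]
  exact integral_congr_ae (ae_of_all _ fun p => kernelProc_swap k p ω)

/-- **Binary splitting of `T_k`**:
`T_k = B_k([0,½]²) + B_k([½,1]²) + 2 B_k([0,½]×[½,1])`. [cite: LeGall1994, (4)–(5)] -/
theorem mollifiedSILT_split (hcont : ∀ ω, Continuous (Z · ω)) (k : ℕ) (ω : Ω) :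
    mollifiedSILT Z k ω = blockSILT Z k 0 (1 / 2) 0 (1 / 2) ω + blockSILT Z k (1 / 2) 1 (1 / 2) 1 ω +
      2 * blockSILT Z k 0 (1 / 2) (1 / 2) 1 ω := by
  rw [mollifiedSILT_eq_integral_kernelProc hcont, unitSq_split]
  have hi := fun a b c d => integrable_kernelProc_rect hcont k a b c d ω
  rw [integral_add_measure ((hi _ _ _ _).add_measure (hi _ _ _ _)) ((hi _ _ _ _).add_measure (hi _ _ _ _)),
    integral_add_measure (hi _ _ _ _) (hi _ _ _ _), integral_add_measure (hi _ _ _ _) (hi _ _ _ _)]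
  change blockSILT Z k 0 (1 / 2) 0 (1 / 2) ω + blockSILT Z k 0 (1 / 2) (1 / 2) 1 ω +
      (blockSILT Z k (1 / 2) 1 0 (1 / 2) ω + blockSILT Z k (1 / 2) 1 (1 / 2) 1 ω) = _
  rw [blockSILT_offDiag_swap]
  ring

/-- **Binary splitting with scaling**: for every `k`,
`T_{2k}(Z) = ½ T_k(halfScale Z) + ½ T_k(halfShiftScale Z) + 2 B_{2k}([0,½]×[½,1])`, pathwise.
[cite: LeGall1994, (4)–(5) and fact (ii)] -/
theorem mollifiedSILT_two_mul (hcont : ∀ ω, Continuous (Z · ω)) (k : ℕ) (ω : Ω) :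
    mollifiedSILT Z (2 * k) ω = 1 / 2 * mollifiedSILT (halfScale Z) k ω +
      1 / 2 * mollifiedSILT (halfShiftScale Z) k ω + 2 * blockSILT Z (2 * k) 0 (1 / 2) (1 / 2) 1 ω := by
  rw [mollifiedSILT_split hcont, blockSILT_lowerDiag hcont, blockSILT_upperDiag hcont]

end Edwards2D

end Literature.Barriers.CriticalPhenomena
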